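/-
Copyright (c) 2026 the pub-hodgecm-mathlib formalisation cell (harness21).  Prover seat hodgecm-mathlib-LH4-p08 (g4), Track A «(D-RAM) FOUR-FRAME», unit U2H, the census leaf
(ρ2b′-X) `stub_U2H_fixedPointCensus_typeTwo_unit0` — dealer LH4-plan (g12) WORD #16∕#21 hand T5a «TORIC LEVEL CENSUS» (payer LH4-p14; plan owner LH4-p12 (g4)):
the u-FREE ROWS OF THE DEPTH-REFINED CENSUS — level 0, off-diagonal (LOW ∕ DEAD) and the low half of the diagonal — over the ★ DEFS leaf `levelSetDep`.  2026-09-04.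
-/
import Summits.HodgeConjecture.HodgeConjecture.Theorems.F0P3cDyRamToricCensusDefs   -- ★ p857239 (LH4-p12 (g4)): `IsOrd`, `dualGen`, `levelSet`, `levelSetDep`
import Literature.NumberTheory.LocalFields.QuadraticOrderDepthScaling               -- ★ (LH4-p12 (g4)): (D0) `forall_dual_mul_mem_iff_depthUnit` → ★ T4c hermitian dual
import Literature.NumberTheory.LocalFields.QuadraticOrderHermitianLevel              -- ★ p857226 (this seat): dichotomy, `ρy = −θy`, depth-of-a-quotient (max-)lemma
import HarnessLib

/-!
# T5a: the u-free rows of the depth-refined level census (`levelSetDep`), M∕E-unramified frame, BOTH sides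

Tokens: `|μ| = exp(−m)`, `|μ − ρμ| = exp(−jλ)` (`μ = λ − u`; `κ := ρμ∕μ` has `ρ`-depth `ℓ := jλ − m`), level `a`, tree level `j ≤ jλ`, `c := j − a`.  The depth
condition `μΛ^# ⊆ Λ` of `levelSetDep` is, by ★ (D0) `forall_dual_mul_mem_iff_depthUnit`, `a ≤ m ∧ (j ≤ m − a ∨ z ∈ 𝒪_{j−(m−a)})` for the UNIT `z := μ∕(y·ϖE^{m−a})`,
and the `ρ`-depth of `z` is `min(c, ℓ)` off the diagonal `c ≠ ℓ` (★ `v_depthQuot_sub_map_eq_max`) and `≥ c` on it.  Hence, with NO side hypothesis and NO counting: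

* (R1-A0) `levelSetDep(j, 0; μ) = levelSet(j, 0)` (`j ≤ jλ`);
* (R1-OFF) off the diagonal (`a ≥ 1`, `j + m ≠ jλ + a`): `levelSetDep(j,a;μ) = levelSet(j,a)` if `2a ≤ m ∧ (j + a ≤ m ∨ j + a ≤ jλ)`, `= ∅` otherwise — u-FREE;
* (R1-DIAG-LOW) on the diagonal with `2a ≤ m`: `levelSetDep(j,a;μ) = levelSet(j,a)`;
and the `ncard` forms of the T5a sheet (E1 `dep` rows: A0 598 + LOW 1118 + DIAG 192 cells, 0 mismatches).  The TOP half of the diagonal (`2a > m`) is the only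
`ω`-sensitive region (separate file).
HONEST LABEL: HC_CM is proved only modulo the 7 printed citations (2 remaining named inputs: hLiu418 = stmt-HodgeConjecture-24832,
h413 = stmt-HodgeConjecture-24833) until rung 0 closes; (ρ2b′-X) :418 is an OPEN prover target — this file is a helper (`--supports`), proofs only.
-/

set_option autoImplicit false

open WithZero

namespace Summit.HodgeConjecture.HodgeConjecture.Cruxes.H413.F0P3cDyRamToricLevelCensusUnr

open Summit.HodgeConjecture.HodgeConjecture.Cruxes.H413.F0P3cDyRamToricCensusDefs
open Literature.NumberTheory.LocalFields.QuadraticOrder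

variable {K : Type*} [Field K] [Valued K ℤᵐ⁰] {ρ Θ : K →+* K} {α ϖE h : K}

/-- `exp(−n) = exp(−1)^n` bookkeeping: `|ϖE|^n = exp(−n)`. [cite: Serre1979, Ch. II §1] -/
theorem v_pow_eq_exp_neg (hϖE : Valued.v ϖE = exp (-1 : ℤ)) (n : ℕ) : Valued.v ϖE ^ n = exp (-(n : ℤ)) := by
  rw [hϖE, ← exp_nsmul, nsmul_eq_mul, mul_neg, mul_one]

/-- **THE DEPTH CONDITION READ ON A MEMBER OF A LEVEL SET (tokens only, plus the unit `z`).**  For `Λ ∈ levelSet(j,a)` with witness `x₀` (so `y = dualGen x₀`,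
`|y| = exp(−a)`) and `|μ| = exp(−m)`: `μΛ^# ⊆ Λ ⟺ a ≤ m ∧ (j + a ≤ m ∨ |z − ρz| ≤ exp(−(j + a − m)))` where `z := μ ∕ (y·ϖE^{m−a})` is a unit — ★ (D0) with
`|α − ρα| = 1`. [cite: Jacobowitz1962, §4] [cite: Serre1979, Ch. III §6 Prop. 12] -/
theorem dep_iff_of_witness (hρρ : ∀ x, ρ (ρ x) = x) (hvρ : ∀ x, Valued.v (ρ x) = Valued.v x) (hΘΘ : ∀ x, Θ (Θ x) = x) (hΘρ : ∀ x, Θ (ρ x) = ρ (Θ x))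
    (hvΘ : ∀ x, Valued.v (Θ x) = Valued.v x) (hα1 : Valued.v α ≤ 1) (hα : Valued.v (α - ρ α) = 1)
    (hρϖE : ρ ϖE = ϖE) (hϖE : Valued.v ϖE = exp (-1 : ℤ)) (hh : h ≠ 0)
    {μ : K} {m : ℕ} (hm : Valued.v μ = exp (-(m : ℤ))) {j a : ℕ} {Λ : AddSubgroup K} {x₀ : K} (hx₀ : x₀ ≠ 0)
    (hΛ : ∀ x, x ∈ Λ ↔ ∃ z, IsOrd ρ α (ϖE ^ j) z ∧ x = x₀ * z) (hya : Valued.v (dualGen ρ Θ α (ϖE ^ j) h x₀) = Valued.v ϖE ^ a) :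
    (∀ b, (∀ x ∈ Λ, Valued.v (h * Θ x * b + ρ (h * Θ x * b)) ≤ 1) → μ * b ∈ Λ) ↔
      a ≤ m ∧ (j + a ≤ m ∨
        Valued.v (μ / (dualGen ρ Θ α (ϖE ^ j) h x₀ * ϖE ^ (m - a)) - ρ (μ / (dualGen ρ Θ α (ϖE ^ j) h x₀ * ϖE ^ (m - a)))) ≤
          exp (-((j + a : ℕ) - (m : ℤ)))) := by
  have hϖ0 : ϖE ≠ 0 := fun h0 => by rw [h0, map_zero] at hϖE; exact (exp_ne_zero hϖE.symm).elim
  have hϖ1 : Valued.v ϖE < 1 := by rw [hϖE, ← exp_zero, exp_lt_exp]; norm_num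
  have hαne : ρ α ≠ α := fun h0 => by rw [h0, sub_self, map_zero] at hα; exact zero_ne_one hα
  have hint : ∀ z : K, Valued.v z ≤ 1 → Valued.v ((z - ρ z) / (α - ρ α)) ≤ 1 := fun z hz => by
    rw [map_div₀, hα, div_one]
    exact (Valuation.map_sub _ _ _).trans (by rw [hvρ, max_self]; exact hz)
  have hμ : Valued.v μ = Valued.v ϖE ^ m := by rw [hm, v_pow_eq_exp_neg hϖE]
  simp only [dualGen] at hya ⊢
  rw [forall_dual_mul_mem_iff_depthUnit hρρ hvρ hαne hα1 hint hΘΘ hΘρ hvΘ hρϖE hϖ0 hϖ1 hh hx₀ j hΛ hya hμ]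
  -- the unit clause: `|z| = 1` when `a ≤ m`, and the conductor bound is `exp(−(j + a − m))` unless `j + a ≤ m`
  constructor
  · rintro ⟨ham, hor⟩
    refine ⟨ham, ?_⟩
    rcases hor with hjm | ⟨_, hz⟩
    · exact Or.inl (by omega)
    · by_cases hjam : j + a ≤ m
      · exact Or.inl hjam
      · right
        refine hz.trans_eq ?_
        rw [map_mul, hα, mul_one, map_pow, v_pow_eq_exp_neg hϖE]
        congr 1; omega
  · rintro ⟨ham, hor⟩
    refine ⟨ham, ?_⟩
    by_cases hjam : j + a ≤ m
    · exact Or.inl (by omega)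
    · rcases hor with hjam' | hz
      · exact absurd hjam' hjam
      · right
        refine ⟨?_, ?_⟩
        · rw [map_div₀, map_mul, hya, map_pow, hμ, ← pow_add, Nat.add_sub_cancel' ham, div_self (pow_ne_zero _ ((Valuation.ne_zero_iff _).2 hϖ0))]
        · refine hz.trans_eq ?_
          rw [map_mul, hα, mul_one, map_pow, v_pow_eq_exp_neg hϖE]
          congr 1; omega


/-- **THE `ρ`-TWIST OF THE DEPTH UNIT.**  For `x₀ ≠ 0`, `y = h·x₀Θx₀·ϖE^j(α − ρα)` with `|y| = |ϖE|^a`, `a ≤ m`, `|μ| = exp(−m)`, `|μ − ρμ| = exp(−jλ)`, the unit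
`z = μ∕(y·ϖE^{m−a})` has `|z − ρz| = |(1 + θ) + (κ − 1)|` with `θ = (ρh∕h)(ρN∕N)` (`ρy = −θy`, ★ `map_hermGen_eq_neg_mul`) and `|κ − 1| = exp(m − jλ)` (`κ = ρμ∕μ`).
[cite: Jacobowitz1962, §4] [cite: Serre1979, Ch. V §3] -/
theorem v_depthUnit_sub_map_eq (hρρ : ∀ x, ρ (ρ x) = x) (hvρ : ∀ x, Valued.v (ρ x) = Valued.v x)
    (hρϖE : ρ ϖE = ϖE) (hϖE : Valued.v ϖE = exp (-1 : ℤ)) (hh : h ≠ 0)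
    {μ : K} {m jl : ℕ} (hm : Valued.v μ = exp (-(m : ℤ))) (hjl : Valued.v (μ - ρ μ) = exp (-(jl : ℤ)))
    {j a : ℕ} (ham : a ≤ m) {x₀ : K} (hx₀ : x₀ ≠ 0) (hΘx₀ : Θ x₀ ≠ 0)
    (hya : Valued.v (h * (x₀ * Θ x₀) * (ϖE ^ j * (α - ρ α))) = Valued.v ϖE ^ a) :
    Valued.v (μ / (h * (x₀ * Θ x₀) * (ϖE ^ j * (α - ρ α)) * ϖE ^ (m - a)) - ρ (μ / (h * (x₀ * Θ x₀) * (ϖE ^ j * (α - ρ α)) * ϖE ^ (m - a)))) =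
        Valued.v ((1 + ρ h / h * (ρ (x₀ * Θ x₀) / (x₀ * Θ x₀))) + (ρ μ / μ - 1)) ∧
      Valued.v (ρ μ / μ - 1) = exp ((m : ℤ) - jl) := by
  have hϖ0 : ϖE ≠ 0 := fun h0 => by rw [h0, map_zero] at hϖE; exact (exp_ne_zero hϖE.symm).elim
  have hμ0 : μ ≠ 0 := fun h0 => by rw [h0, map_zero] at hm; exact (exp_ne_zero hm.symm).elim
  have hN0 : x₀ * Θ x₀ ≠ 0 := mul_ne_zero hx₀ hΘx₀
  have hc : ρ (ϖE ^ j) = ϖE ^ j := by rw [map_pow, hρϖE]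
  have hy0 : h * (x₀ * Θ x₀) * (ϖE ^ j * (α - ρ α)) ≠ 0 := fun h0 => by
    rw [h0, map_zero, v_pow_eq_exp_neg hϖE] at hya; exact (exp_ne_zero hya.symm).elim
  have hρy := map_hermGen_eq_neg_mul (ρ := ρ) (Θ := Θ) (α := α) hρρ hc hh hx₀ hΘx₀
  have hθ : Valued.v (ρ h / h * (ρ (x₀ * Θ x₀) / (x₀ * Θ x₀))) = 1 := by
    rw [map_mul, map_div₀, map_div₀, hvρ, hvρ, div_self ((Valuation.ne_zero_iff _).2 hh),
      div_self ((Valuation.ne_zero_iff _).2 hN0), mul_one]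
  have hy'0 : h * (x₀ * Θ x₀) * (ϖE ^ j * (α - ρ α)) * ϖE ^ (m - a) ≠ 0 := mul_ne_zero hy0 (pow_ne_zero _ hϖ0)
  have hρy' : ρ (h * (x₀ * Θ x₀) * (ϖE ^ j * (α - ρ α)) * ϖE ^ (m - a)) =
      -(ρ h / h * (ρ (x₀ * Θ x₀) / (x₀ * Θ x₀)) * (h * (x₀ * Θ x₀) * (ϖE ^ j * (α - ρ α)) * ϖE ^ (m - a))) := by
    rw [map_mul ρ _ (ϖE ^ (m - a)), map_pow, hρϖE, hρy]; ring
  have key := v_depthQuot_sub_map_eq (ρ := ρ) hρy' hθ hy'0 (map_zero ρ) hμ0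
  simp only [sub_zero] at key
  have hvz : Valued.v (μ / (h * (x₀ * Θ x₀) * (ϖE ^ j * (α - ρ α)) * ϖE ^ (m - a))) = 1 := by
    rw [map_div₀, map_mul, hya, map_pow, hm, ← pow_add, Nat.add_sub_cancel' ham, v_pow_eq_exp_neg hϖE, div_self exp_ne_zero]
  refine ⟨by rw [key.1, hvz, one_mul], ?_⟩
  rw [key.2, hjl, hm, ← exp_sub]; congr 1; ring

/-- **THE TWIST DEPTH OF A GENERATOR**: for `x₀` witnessing `Λ ∈ levelSet(j,a)` (`y` integral, Gram-primitive, `|y| = |ϖE|^a`): `|1 + θ| = exp(a − j)` if `a ≥ 1`,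
`|1 + θ| ≤ exp(−j)` if `a = 0`, and `a ≤ j` (★ dichotomy + `|y − ρy| = |y|·|1 + θ|`). [cite: Jacobowitz1962, §4] -/
theorem v_one_add_twist_of_gen (hρρ : ∀ x, ρ (ρ x) = x) (hvρ : ∀ x, Valued.v (ρ x) = Valued.v x) (hα : Valued.v (α - ρ α) = 1)
    (hρϖE : ρ ϖE = ϖE) (hϖE : Valued.v ϖE = exp (-1 : ℤ)) (hh : h ≠ 0) {j a : ℕ} {x₀ : K} (hx₀ : x₀ ≠ 0) (hΘx₀ : Θ x₀ ≠ 0)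
    (hyO : IsOrd ρ α (ϖE ^ j) (h * (x₀ * Θ x₀) * (ϖE ^ j * (α - ρ α))))
    (hyN : ¬ IsOrd ρ α (ϖE ^ j) (h * (x₀ * Θ x₀) * (ϖE ^ j * (α - ρ α)) / ϖE))
    (hya : Valued.v (h * (x₀ * Θ x₀) * (ϖE ^ j * (α - ρ α))) = Valued.v ϖE ^ a) :
    (1 ≤ a → Valued.v (1 + ρ h / h * (ρ (x₀ * Θ x₀) / (x₀ * Θ x₀))) = exp ((a : ℤ) - j)) ∧
      (a = 0 → Valued.v (1 + ρ h / h * (ρ (x₀ * Θ x₀) / (x₀ * Θ x₀))) ≤ exp (-(j : ℤ))) ∧ a ≤ j := by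
  have hϖ0 : ϖE ≠ 0 := fun h0 => by rw [h0, map_zero] at hϖE; exact (exp_ne_zero hϖE.symm).elim
  have hN0 : x₀ * Θ x₀ ≠ 0 := mul_ne_zero hx₀ hΘx₀
  have hc : ρ (ϖE ^ j) = ϖE ^ j := by rw [map_pow, hρϖE]
  have hc0 : ϖE ^ j ≠ 0 := pow_ne_zero _ hϖ0
  have hvc : Valued.v (ϖE ^ j) = exp (-(j : ℤ)) := by rw [map_pow, v_pow_eq_exp_neg hϖE]
  have hdich := (hermGen_order_and_not_order_div_iff (ρ := ρ) (Θ := Θ) hα hϖE hρϖE hc0 h x₀).1 ⟨hyO, hyN⟩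
  have htw := v_hermGen_sub_map_eq (ρ := ρ) (Θ := Θ) (α := α) hρρ hc hh hx₀ hΘx₀
  rw [v_pow_eq_exp_neg hϖE] at hya
  rw [hya] at htw hdich
  have hθ : Valued.v (ρ h / h * (ρ (x₀ * Θ x₀) / (x₀ * Θ x₀))) = 1 := by
    rw [map_mul, map_div₀, map_div₀, hvρ, hvρ, div_self ((Valuation.ne_zero_iff _).2 hh),
      div_self ((Valuation.ne_zero_iff _).2 hN0), mul_one]
  have hθ1 : Valued.v (1 + ρ h / h * (ρ (x₀ * Θ x₀) / (x₀ * Θ x₀))) ≤ 1 :=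
    (Valuation.map_add _ _ _).trans (by rw [Valuation.map_one, hθ, max_self])
  have h1θ : Valued.v (1 + ρ h / h * (ρ (x₀ * Θ x₀) / (x₀ * Θ x₀))) =
      Valued.v (h * (x₀ * Θ x₀) * (ϖE ^ j * (α - ρ α)) - ρ (h * (x₀ * Θ x₀) * (ϖE ^ j * (α - ρ α)))) * exp (a : ℤ) := by
    rw [htw, mul_comm (exp (-(a : ℤ))), mul_assoc, ← exp_add, neg_add_cancel, exp_zero, mul_one]
  have hpos : 1 ≤ a → Valued.v (1 + ρ h / h * (ρ (x₀ * Θ x₀) / (x₀ * Θ x₀))) = exp ((a : ℤ) - j) := fun ha => by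
    rcases hdich with ⟨h1, _⟩ | ⟨_, h2⟩
    · exfalso
      rw [← exp_zero, exp_inj] at h1
      omega
    · rw [h1θ, h2, hvc, ← exp_add]; congr 1; ring
  refine ⟨hpos, fun ha0 => ?_, ?_⟩
  · subst ha0
    rw [h1θ, Nat.cast_zero, exp_zero, mul_one]
    rcases hdich with ⟨_, h2⟩ | ⟨_, h2⟩
    · exact hvc ▸ h2
    · exact (h2.trans hvc).le
  · by_cases ha : 1 ≤ a
    · have h1 := hpos ha ▸ hθ1
      rw [← exp_zero, exp_le_exp] at h1
      omega
    · omega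

/-! ## §2 The three u-free rows -/

/-- **(R1-A0) LEVEL 0 ALWAYS PASSES**: `levelSetDep(j, 0; μ) = levelSet(j, 0)` for `|μ| = exp(−m)`, `|μ − ρμ| = exp(−jλ)`, `j ≤ jλ` (the depth unit has
`|z − ρz| ≤ max(exp(−j), exp(m − jλ)) ≤ exp(m − j)`). [cite: Jacobowitz1962, §4] [cite: Serre1979, Ch. V §3] -/
theorem levelSetDep_zero_eq (hρρ : ∀ x, ρ (ρ x) = x) (hvρ : ∀ x, Valued.v (ρ x) = Valued.v x) (hΘΘ : ∀ x, Θ (Θ x) = x)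
    (hΘρ : ∀ x, Θ (ρ x) = ρ (Θ x)) (hvΘ : ∀ x, Valued.v (Θ x) = Valued.v x) (hα1 : Valued.v α ≤ 1) (hα : Valued.v (α - ρ α) = 1)
    (hρϖE : ρ ϖE = ϖE) (hϖE : Valued.v ϖE = exp (-1 : ℤ)) (hh : h ≠ 0)
    {μ : K} {m jl : ℕ} (hm : Valued.v μ = exp (-(m : ℤ))) (hjl : Valued.v (μ - ρ μ) = exp (-(jl : ℤ))) {j : ℕ} (hj : j ≤ jl) :
    levelSetDep ρ Θ α ϖE h j 0 μ = levelSet ρ Θ α ϖE h j 0 := by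
  ext Λ
  rw [mem_levelSetDep_iff]
  refine ⟨fun hΛ => hΛ.1, fun hΛ => ⟨hΛ, ?_⟩⟩
  obtain ⟨x₀, hx₀, hΛx, hyO, hyN, hya⟩ := hΛ
  have hΘx₀ : Θ x₀ ≠ 0 := (map_ne_zero Θ).2 hx₀
  rw [dep_iff_of_witness hρρ hvρ hΘΘ hΘρ hvΘ hα1 hα hρϖE hϖE hh hm hx₀ hΛx hya]
  refine ⟨Nat.zero_le _, ?_⟩
  by_cases hjm : j + 0 ≤ m
  · exact Or.inl hjm
  right
  simp only [dualGen] at hyO hyN hya ⊢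
  obtain ⟨hz, hκ⟩ := v_depthUnit_sub_map_eq hρρ hvρ hρϖE hϖE hh hm hjl (Nat.zero_le m) hx₀ hΘx₀ hya
  obtain ⟨-, hzero, -⟩ := v_one_add_twist_of_gen hρρ hvρ hα hρϖE hϖE hh hx₀ hΘx₀ hyO hyN hya
  rw [hz]
  refine (Valuation.map_add _ _ _).trans (max_le ((hzero rfl).trans ?_) (hκ.trans_le ?_))
  · rw [exp_le_exp]; omega
  · rw [exp_le_exp]; omega

/-- **(R1-OFF) OFF THE DIAGONAL THE DEPTH CONDITION IS u-FREE**: for `a ≥ 1` and `j + m ≠ jλ + a` (`c ≠ ℓ`), `levelSetDep(j,a;μ) = levelSet(j,a)` if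
`2a ≤ m ∧ (j + a ≤ m ∨ j + a ≤ jλ)` and `= ∅` otherwise (the depth unit has `|z − ρz| = max(exp(a − j), exp(m − jλ))` EXACTLY, ★ max-lemma).
[cite: Jacobowitz1962, §4] [cite: Serre1979, Ch. V §3] -/
theorem levelSetDep_eq_of_offDiag (hρρ : ∀ x, ρ (ρ x) = x) (hvρ : ∀ x, Valued.v (ρ x) = Valued.v x) (hΘΘ : ∀ x, Θ (Θ x) = x)
    (hΘρ : ∀ x, Θ (ρ x) = ρ (Θ x)) (hvΘ : ∀ x, Valued.v (Θ x) = Valued.v x) (hα1 : Valued.v α ≤ 1) (hα : Valued.v (α - ρ α) = 1)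
    (hρϖE : ρ ϖE = ϖE) (hϖE : Valued.v ϖE = exp (-1 : ℤ)) (hh : h ≠ 0)
    {μ : K} {m jl : ℕ} (hm : Valued.v μ = exp (-(m : ℤ))) (hjl : Valued.v (μ - ρ μ) = exp (-(jl : ℤ)))
    {j a : ℕ} (ha : 1 ≤ a) (hoff : j + m ≠ jl + a) :
    levelSetDep ρ Θ α ϖE h j a μ = if 2 * a ≤ m ∧ (j + a ≤ m ∨ j + a ≤ jl) then levelSet ρ Θ α ϖE h j a else ∅ := by
  -- pointwise: for a member of the level set the depth condition is the token condition
  have hpt : ∀ Λ, Λ ∈ levelSet ρ Θ α ϖE h j a →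
      ((∀ b, (∀ x ∈ Λ, Valued.v (h * Θ x * b + ρ (h * Θ x * b)) ≤ 1) → μ * b ∈ Λ) ↔ (2 * a ≤ m ∧ (j + a ≤ m ∨ j + a ≤ jl))) := by
    intro Λ hΛ
    obtain ⟨x₀, hx₀, hΛx, hyO, hyN, hya⟩ := hΛ
    have hΘx₀ : Θ x₀ ≠ 0 := (map_ne_zero Θ).2 hx₀
    rw [dep_iff_of_witness hρρ hvρ hΘΘ hΘρ hvΘ hα1 hα hρϖE hϖE hh hm hx₀ hΛx hya]
    simp only [dualGen] at hyO hyN hya ⊢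
    obtain ⟨hpos, -, haj⟩ := v_one_add_twist_of_gen hρρ hvρ hα hρϖE hϖE hh hx₀ hΘx₀ hyO hyN hya
    have hθ := hpos ha
    by_cases ham : a ≤ m
    · obtain ⟨hz, hκ⟩ := v_depthUnit_sub_map_eq hρρ hvρ hρϖE hϖE hh hm hjl ham hx₀ hΘx₀ hya
      have hne : Valued.v (1 + ρ h / h * (ρ (x₀ * Θ x₀) / (x₀ * Θ x₀))) ≠ Valued.v (ρ μ / μ - 1) := by
        rw [hθ, hκ, Ne, exp_inj]; omega
      have hmax : Valued.v ((1 + ρ h / h * (ρ (x₀ * Θ x₀) / (x₀ * Θ x₀))) + (ρ μ / μ - 1)) = exp (max ((a : ℤ) - j) ((m : ℤ) - jl)) := by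
        rw [Valuation.map_add_of_distinct_val _ hne, hθ, hκ]
        rcases le_total ((a : ℤ) - j) ((m : ℤ) - jl) with hle | hle
        · rw [max_eq_right (exp_le_exp.2 hle), max_eq_right hle]
        · rw [max_eq_left (exp_le_exp.2 hle), max_eq_left hle]
      rw [hz, hmax, exp_le_exp, max_le_iff]
      constructor
      · rintro ⟨-, h1 | ⟨h2, h3⟩⟩
        · exact ⟨by omega, Or.inl h1⟩
        · exact ⟨by omega, by omega⟩
      · rintro ⟨h1, h2⟩
        exact ⟨ham, by omega⟩
    · constructor
      · rintro ⟨h1, -⟩; exact absurd h1 ham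
      · rintro ⟨h1, -⟩; exfalso; omega
  split_ifs with hc
  · ext Λ
    rw [mem_levelSetDep_iff]
    exact ⟨fun hΛ => hΛ.1, fun hΛ => ⟨hΛ, (hpt Λ hΛ).2 hc⟩⟩
  · ext Λ
    rw [mem_levelSetDep_iff]
    simp only [Set.mem_empty_iff_false, iff_false, not_and]
    exact fun hΛ hdep => hc ((hpt Λ hΛ).1 hdep)

/-- **(R1-DIAG-LOW) THE LOW HALF OF THE DIAGONAL PASSES**: for `a ≥ 1`, `j + m = jλ + a` (`c = ℓ`) and `2a ≤ m`, `levelSetDep(j,a;μ) = levelSet(j,a)`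
(`|z − ρz| ≤ max(exp(a − j), exp(m − jλ)) = exp(a − j) ≤ exp(m − j − a)`). [cite: Jacobowitz1962, §4] [cite: Serre1979, Ch. V §3] -/
theorem levelSetDep_eq_of_diag_low (hρρ : ∀ x, ρ (ρ x) = x) (hvρ : ∀ x, Valued.v (ρ x) = Valued.v x) (hΘΘ : ∀ x, Θ (Θ x) = x)
    (hΘρ : ∀ x, Θ (ρ x) = ρ (Θ x)) (hvΘ : ∀ x, Valued.v (Θ x) = Valued.v x) (hα1 : Valued.v α ≤ 1) (hα : Valued.v (α - ρ α) = 1)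
    (hρϖE : ρ ϖE = ϖE) (hϖE : Valued.v ϖE = exp (-1 : ℤ)) (hh : h ≠ 0)
    {μ : K} {m jl : ℕ} (hm : Valued.v μ = exp (-(m : ℤ))) (hjl : Valued.v (μ - ρ μ) = exp (-(jl : ℤ)))
    {j a : ℕ} (ha : 1 ≤ a) (hdiag : j + m = jl + a) (hlow : 2 * a ≤ m) :
    levelSetDep ρ Θ α ϖE h j a μ = levelSet ρ Θ α ϖE h j a := by
  ext Λ
  rw [mem_levelSetDep_iff]
  refine ⟨fun hΛ => hΛ.1, fun hΛ => ⟨hΛ, ?_⟩⟩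
  obtain ⟨x₀, hx₀, hΛx, hyO, hyN, hya⟩ := hΛ
  have hΘx₀ : Θ x₀ ≠ 0 := (map_ne_zero Θ).2 hx₀
  rw [dep_iff_of_witness hρρ hvρ hΘΘ hΘρ hvΘ hα1 hα hρϖE hϖE hh hm hx₀ hΛx hya]
  have ham : a ≤ m := by omega
  refine ⟨ham, ?_⟩
  by_cases hjm : j + a ≤ m
  · exact Or.inl hjm
  right
  simp only [dualGen] at hyO hyN hya ⊢
  obtain ⟨hz, hκ⟩ := v_depthUnit_sub_map_eq hρρ hvρ hρϖE hϖE hh hm hjl ham hx₀ hΘx₀ hya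
  obtain ⟨hpos, -, -⟩ := v_one_add_twist_of_gen hρρ hvρ hα hρϖE hϖE hh hx₀ hΘx₀ hyO hyN hya
  rw [hz]
  refine (Valuation.map_add _ _ _).trans (max_le ((hpos ha).trans_le ?_) (hκ.trans_le ?_))
  · rw [exp_le_exp]; omega
  · rw [exp_le_exp]; omega

/-! ## §3 The `ncard` forms of the T5a sheet -/

/-- **(R1-A0), counted**: `#levelSetDep(j, 0; μ) = #levelSet(j, 0)` (`j ≤ jλ`). [cite: Jacobowitz1962, §4] -/
theorem ncard_levelSetDep_zero (hρρ : ∀ x, ρ (ρ x) = x) (hvρ : ∀ x, Valued.v (ρ x) = Valued.v x) (hΘΘ : ∀ x, Θ (Θ x) = x)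
    (hΘρ : ∀ x, Θ (ρ x) = ρ (Θ x)) (hvΘ : ∀ x, Valued.v (Θ x) = Valued.v x) (hα1 : Valued.v α ≤ 1) (hα : Valued.v (α - ρ α) = 1)
    (hρϖE : ρ ϖE = ϖE) (hϖE : Valued.v ϖE = exp (-1 : ℤ)) (hh : h ≠ 0)
    {μ : K} {m jl : ℕ} (hm : Valued.v μ = exp (-(m : ℤ))) (hjl : Valued.v (μ - ρ μ) = exp (-(jl : ℤ))) {j : ℕ} (hj : j ≤ jl) :
    (levelSetDep ρ Θ α ϖE h j 0 μ).ncard = (levelSet ρ Θ α ϖE h j 0).ncard := by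
  rw [levelSetDep_zero_eq hρρ hvρ hΘΘ hΘρ hvΘ hα1 hα hρϖE hϖE hh hm hjl hj]

/-- **(R1-OFF), counted**: `#levelSetDep(j,a;μ) = [2a ≤ m ∧ (j + a ≤ m ∨ j + a ≤ jλ)] · #levelSet(j,a)` off the diagonal. [cite: Jacobowitz1962, §4] -/
theorem ncard_levelSetDep_offDiag (hρρ : ∀ x, ρ (ρ x) = x) (hvρ : ∀ x, Valued.v (ρ x) = Valued.v x) (hΘΘ : ∀ x, Θ (Θ x) = x)
    (hΘρ : ∀ x, Θ (ρ x) = ρ (Θ x)) (hvΘ : ∀ x, Valued.v (Θ x) = Valued.v x) (hα1 : Valued.v α ≤ 1) (hα : Valued.v (α - ρ α) = 1)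
    (hρϖE : ρ ϖE = ϖE) (hϖE : Valued.v ϖE = exp (-1 : ℤ)) (hh : h ≠ 0)
    {μ : K} {m jl : ℕ} (hm : Valued.v μ = exp (-(m : ℤ))) (hjl : Valued.v (μ - ρ μ) = exp (-(jl : ℤ)))
    {j a : ℕ} (ha : 1 ≤ a) (hoff : j + m ≠ jl + a) :
    (levelSetDep ρ Θ α ϖE h j a μ).ncard = if 2 * a ≤ m ∧ (j + a ≤ m ∨ j + a ≤ jl) then (levelSet ρ Θ α ϖE h j a).ncard else 0 := by
  rw [levelSetDep_eq_of_offDiag hρρ hvρ hΘΘ hΘρ hvΘ hα1 hα hρϖE hϖE hh hm hjl ha hoff]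
  split_ifs
  · rfl
  · exact Set.ncard_empty _

/-- **(R1-DIAG-LOW), counted**: `#levelSetDep(j,a;μ) = #levelSet(j,a)` on the low half of the diagonal. [cite: Jacobowitz1962, §4] -/
theorem ncard_levelSetDep_diag_low (hρρ : ∀ x, ρ (ρ x) = x) (hvρ : ∀ x, Valued.v (ρ x) = Valued.v x) (hΘΘ : ∀ x, Θ (Θ x) = x)
    (hΘρ : ∀ x, Θ (ρ x) = ρ (Θ x)) (hvΘ : ∀ x, Valued.v (Θ x) = Valued.v x) (hα1 : Valued.v α ≤ 1) (hα : Valued.v (α - ρ α) = 1)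
    (hρϖE : ρ ϖE = ϖE) (hϖE : Valued.v ϖE = exp (-1 : ℤ)) (hh : h ≠ 0)
    {μ : K} {m jl : ℕ} (hm : Valued.v μ = exp (-(m : ℤ))) (hjl : Valued.v (μ - ρ μ) = exp (-(jl : ℤ)))
    {j a : ℕ} (ha : 1 ≤ a) (hdiag : j + m = jl + a) (hlow : 2 * a ≤ m) :
    (levelSetDep ρ Θ α ϖE h j a μ).ncard = (levelSet ρ Θ α ϖE h j a).ncard := by
  rw [levelSetDep_eq_of_diag_low hρρ hvρ hΘΘ hΘρ hvΘ hα1 hα hρϖE hϖE hh hm hjl ha hdiag hlow]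

end Summit.HodgeConjecture.HodgeConjecture.Cruxes.H413.F0P3cDyRamToricLevelCensusUnr
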